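import Summits.Ventures.HSemireg.WedgeHankelRecurrenceKronecker
import Summits.Ventures.HSemireg.WedgeHankelRecurrenceCompanionAlgebra
import Literature.Combinatorics.Enumerative.CFiniteClosureProperties

/-!
# Venture HSemireg — KRONECKER ⟺ C-FINITE: THE DICTIONARY WITH MATHLIB'S `LinearRecurrence` AND THE LITERATURE'S `IsCFinite` (Kauers–Paule Ch. 4), and the matrix model of a dual class.
# **`R^N(q) ≤ d` for every `N` ⟺ `q` solves a `LinearRecurrence` of order `≤ d` ⟺ `IsCFinite r q` for some `r ≤ d`**; hence the CLOSURE PROPERTIES of C-finite sequences typed in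
# `Literature.Combinatorics.Enumerative.CFiniteClosureProperties` (Kauers–Paule Thm. 4.2: sum order `≤ r + s`, termwise product order `≤ rs`, subsequences `q_{mn}` order `≤ r`) transport to
# BOUNDED MIDDLE HANKEL RANKS; and every matrix-entry sequence `j ↦ (A^j B)_{ik}` (in particular a dual class: `dualSeq m a j = (M_X^j · M_a)_{t,0}`) has `R^N ≤ n`
# («LFSR sequence = output of a linear state-space model; sums, Hadamard products and decimations of LFSR sequences are LFSR sequences»)

HONEST FRAMING. Part of the Lean index of the computation cell `pub-hsemireg` (seat p10 gen 31, Sunday typer «UNIFORM-IN-n»).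
LINEAR ALGEBRA OF HANKEL (catalecticant) MATRICES and of polynomials over a field ONLY (`LinearRecurrence`, `Matrix.charpoly`): no variety, no cohomology theory, no sheaf, no Ext group and no
semiregularity map is constructed here; nothing here says that HC / HC_CM / HC_AV holds.  No unproved named fact is used: the PROVED Literature module
`Literature.Combinatorics.Enumerative.CFiniteClosureProperties` (Kauers–Paule, *The Concrete Tetrahedron*, §4.2–§4.3: `IsCFinite`, `isCFinite_iff_linearRecurrence`, `IsCFinite.add`, `IsCFinite.mul`,
`IsCFinite.subseq`, `IsCFinite.mono`) is imported and this file is the DICTIONARY between it and the lineage's Hankel ranks — nothing of it is restated or re-proved.  Custodian versions as in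
`WedgeHankelSiegelIdeal` (1/3).

WHAT IS IN THE TREE ∕ LINEAGE.  N97 (`WedgeHankelRecurrenceKronecker`): `forall_rank_half_le_iff_exists_recurrence` (KRONECKER: bounded ranks ⟺ one monic recurrence at every shift); N91
(`WedgeHankelRecurrenceCompanionAlgebra`): `mulResidueMat_mul`, `mulResidueMat_X_pow`; N73: `mulResidueMat_apply`; N18: `hkFun_apply`, `hkFun_monomial`, `hkFun_eq_sum_range`.  Mathlib:
`LinearRecurrence`, `LinearRecurrence.IsSolution`, `LinearRecurrence.charPoly` ∕ `charPoly_monic` ∕ `charPoly_degree_eq_order`, `Matrix.charpoly_monic`, `Matrix.charpoly_natDegree_eq_dim`,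
`Matrix.aeval_self_charpoly`, `Polynomial.eval₂_eq_sum`.
THIS FILE (namespace `Summit.Ventures.HSemireg.Wedge.HankelOuter` continued; CHAINED on N97 + N91 (+ that Literature module); 0 definitions):
* §656 THE BRIDGE: `hkFun_charPoly` (`⟪χ_E, q⟫_s = q_{s+r} − Σ_i c_i q_{s+i}` for `E : LinearRecurrence K` of order `r`), **`isSolution_iff_forall_hkFun_charPoly_eq_zero`** (`E.IsSolution q ⟺ ⟪χ_E, q⟫_s = 0 ∀ s`),
  `isSolution_of_forall_hkFun_eq_zero` (a monic `m` with `⟪m, q⟫_s = 0 ∀ s` gives the `LinearRecurrence` `⟨deg m, −m_i⟩`), **`forall_rank_half_le_iff_exists_linearRecurrence`** (`R^N(q) ≤ d ∀ N ⟺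
  ∃ E, E.order ≤ d ∧ E.IsSolution q`), **`forall_rank_half_le_iff_exists_isCFinite`** (`⟺ ∃ r ≤ d, IsCFinite r q`); TRANSPORTED CLOSURE (Kauers–Paule Thm. 4.2 via the bridge, no re-proof):
  **`forall_rank_half_mul_le`** (`R^N(q) ≤ d`, `R^N(q′) ≤ d′` for all `N` ⇒ `R^N(q · q′) ≤ d d′`: HADAMARD PRODUCT), `forall_rank_half_add_le'` (`≤ d + d′`), `forall_rank_half_subseq_le`
  (`R^N(n ↦ q_{mn}) ≤ d`: DECIMATION); THE MATRIX MODEL: `hkFun_matrix_entry`, `hkFun_charpoly_matrix_entry` (Cayley–Hamilton as a recurrence), **`rank_half_matrix_entry_le`**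
  (`R^N((A^j B)_{ik}) ≤ n`), **`dualSeq_eq_mulResidueMat_pow_entry`** (`dualSeq m a j = (M_X^j · M_a)_{t,0}`).
Nothing Ext-side.  New names only.
-/

open Module Polynomial
open scoped Matrix Polynomial

namespace Summit.Ventures.HSemireg.Wedge.HankelOuter

open Summit.Ventures.HSemireg.Wedge Summit.Ventures.HSemireg.Wedge.Hankel
open Literature.Combinatorics.Enumerative.CFinite

variable (K : Type*) [Field K]

/-! ## §656. Kronecker ⟺ C-finite; transported closure; the matrix model -/

/-- `⟪χ_E, q⟫_s = q_{s+r} − Σ_i c_i · q_{s+i}` for Mathlib's `E : LinearRecurrence K` of order `r` with coefficients `c` (`χ_E = X^r − Σ_i c_i X^i`). -/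
theorem hkFun_charPoly (E : LinearRecurrence K) (q : ℕ → K) (s : ℕ) : hkFun K q s E.charPoly = q (s + E.order) - ∑ i, E.coeffs i * q (s + i) := by
  rw [LinearRecurrence.charPoly, map_sub, map_sum, hkFun_monomial, one_mul, add_comm]
  refine congrArg _ (Finset.sum_congr rfl fun i _ => ?_)
  rw [hkFun_monomial, add_comm]

/-- **`E.IsSolution q ⟺ ⟪χ_E, q⟫_s = 0` for every shift `s`**: Mathlib's solutions of a linear recurrence are exactly the sequences annihilated by its characteristic polynomial at every shift. -/
theorem isSolution_iff_forall_hkFun_charPoly_eq_zero (E : LinearRecurrence K) (q : ℕ → K) : E.IsSolution q ↔ ∀ s, hkFun K q s E.charPoly = 0 := by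
  simp only [LinearRecurrence.IsSolution, hkFun_charPoly, sub_eq_zero]

/-- a MONIC `m` with `⟪m, q⟫_s = 0` for all `s` makes `q` a solution of the `LinearRecurrence` of order `deg m` with coefficients `−m_i` (`i < deg m`). -/
theorem isSolution_of_forall_hkFun_eq_zero {q : ℕ → K} {m : K[X]} (hm : m.Monic) (h : ∀ s, hkFun K q s m = 0) :
    (⟨m.natDegree, fun i => -m.coeff i⟩ : LinearRecurrence K).IsSolution q := by
  intro n
  have hs := h n
  rw [hkFun_eq_sum_range K q n (Nat.lt_succ_self m.natDegree), Finset.sum_range_succ, hm.coeff_natDegree, one_mul, Finset.sum_range] at hs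
  simp only [neg_mul, Finset.sum_neg_distrib]
  rw [eq_neg_iff_add_eq_zero, add_comm n m.natDegree, ← hs, add_comm]
  exact congrArg₂ _ (Finset.sum_congr rfl fun i _ => by rw [add_comm n]) rfl

/-- **KRONECKER ⟺ MATHLIB'S LINEAR RECURRENCES: `R^N(q) ≤ d` for every `N` iff `q` solves some `LinearRecurrence` of order `≤ d`.** Any field. -/
theorem forall_rank_half_le_iff_exists_linearRecurrence (q : ℕ → K) (d : ℕ) :
    (∀ N, (hankel1 K N (N / 2) q).rank ≤ d) ↔ ∃ E : LinearRecurrence K, E.order ≤ d ∧ E.IsSolution q := by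
  rw [forall_rank_half_le_iff_exists_recurrence]
  constructor
  · rintro ⟨m, hmo, hmd, h⟩
    exact ⟨_, hmd, isSolution_of_forall_hkFun_eq_zero K hmo h⟩
  · rintro ⟨E, hEd, hE⟩
    refine ⟨E.charPoly, E.charPoly_monic, ?_, (isSolution_iff_forall_hkFun_charPoly_eq_zero K E q).mp hE⟩
    rw [Polynomial.natDegree_eq_of_degree_eq_some E.charPoly_degree_eq_order]
    exact hEd

/-- **KRONECKER ⟺ C-FINITE (Kauers–Paule §4.2): `R^N(q) ≤ d` for every `N` iff `IsCFinite r q` for some `r ≤ d`.** Any field. -/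
theorem forall_rank_half_le_iff_exists_isCFinite (q : ℕ → K) (d : ℕ) : (∀ N, (hankel1 K N (N / 2) q).rank ≤ d) ↔ ∃ r ≤ d, IsCFinite r q := by
  rw [forall_rank_half_le_iff_exists_linearRecurrence]
  constructor
  · rintro ⟨E, hEd, hE⟩
    exact ⟨E.order, hEd, (isCFinite_iff_linearRecurrence E.order q).mpr ⟨E, rfl, hE⟩⟩
  · rintro ⟨r, hr, hq⟩
    obtain ⟨E, rfl, hE⟩ := (isCFinite_iff_linearRecurrence r q).mp hq
    exact ⟨E, hr, hE⟩

/-- **THE HADAMARD (TERMWISE) PRODUCT: `R^N(q) ≤ d` and `R^N(q′) ≤ d′` for all `N` ⇒ `R^N(q · q′) ≤ d d′` for all `N`** — Kauers–Paule Thm. 4.2 (2) `IsCFinite.mul` (order `≤ rs`) transported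
through the bridge; no re-proof here. Any field. -/
theorem forall_rank_half_mul_le {q q' : ℕ → K} {d d' : ℕ} (hq : ∀ N, (hankel1 K N (N / 2) q).rank ≤ d) (hq' : ∀ N, (hankel1 K N (N / 2) q').rank ≤ d') (N : ℕ) :
    (hankel1 K N (N / 2) (q * q')).rank ≤ d * d' := by
  obtain ⟨r, hr, hr'⟩ := (forall_rank_half_le_iff_exists_isCFinite K q d).mp hq
  obtain ⟨s, hs, hs'⟩ := (forall_rank_half_le_iff_exists_isCFinite K q' d').mp hq'
  exact (forall_rank_half_le_iff_exists_isCFinite K (q * q') (d * d')).mpr ⟨r * s, Nat.mul_le_mul hr hs, hr'.mul hs'⟩ N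

/-- **THE SUM: `R^N(q + q′) ≤ d + d′`** — Kauers–Paule Thm. 4.2 (1) `IsCFinite.add` transported (N18's `rank_hankel1_add_le` gives the same bound level by level). Any field. -/
theorem forall_rank_half_add_le' {q q' : ℕ → K} {d d' : ℕ} (hq : ∀ N, (hankel1 K N (N / 2) q).rank ≤ d) (hq' : ∀ N, (hankel1 K N (N / 2) q').rank ≤ d') (N : ℕ) :
    (hankel1 K N (N / 2) (q + q')).rank ≤ d + d' := by
  obtain ⟨r, hr, hr'⟩ := (forall_rank_half_le_iff_exists_isCFinite K q d).mp hq
  obtain ⟨s, hs, hs'⟩ := (forall_rank_half_le_iff_exists_isCFinite K q' d').mp hq'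
  exact (forall_rank_half_le_iff_exists_isCFinite K (q + q') (d + d')).mpr ⟨r + s, Nat.add_le_add hr hs, hr'.add hs'⟩ N

/-- **DECIMATION: `R^N(n ↦ q_{mn}) ≤ d`** whenever `R^N(q) ≤ d` for all `N` — Kauers–Paule Thm. 4.2 (4) `IsCFinite.subseq` transported. Any field, any `m`. -/
theorem forall_rank_half_subseq_le {q : ℕ → K} {d : ℕ} (hq : ∀ N, (hankel1 K N (N / 2) q).rank ≤ d) (m N : ℕ) : (hankel1 K N (N / 2) fun n => q (m * n)).rank ≤ d := by
  obtain ⟨r, hr, hr'⟩ := (forall_rank_half_le_iff_exists_isCFinite K q d).mp hq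
  exact (forall_rank_half_le_iff_exists_isCFinite K _ d).mpr ⟨r, hr, hr'.subseq m⟩ N

/-- `⟪p, ((A^j · B)_{ik})_j⟫_s = (p(A) · A^s · B)_{ik}`: the Hankel functional of `p` against a matrix-entry sequence is the `(i,k)` entry of `p(A) A^s B`. -/
theorem hkFun_matrix_entry {n : Type*} [Fintype n] [DecidableEq n] (A B : Matrix n n K) (i k : n) (s : ℕ) (p : K[X]) :
    hkFun K (fun j => (A ^ j * B) i k) s p = (aeval A p * A ^ s * B) i k := by
  rw [hkFun_apply, Polynomial.aeval_def, Polynomial.eval₂_eq_sum, Polynomial.sum_def, Polynomial.sum_def, Finset.sum_mul, Finset.sum_mul, Matrix.sum_apply]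
  refine Finset.sum_congr rfl fun e _ => ?_
  rw [← Algebra.smul_def, Matrix.smul_mul, Matrix.smul_mul, Matrix.smul_apply, smul_eq_mul, ← pow_add]

/-- CAYLEY–HAMILTON AS A RECURRENCE: `⟪χ_A, ((A^j · B)_{ik})_j⟫_s = 0` for every shift `s`. -/
theorem hkFun_charpoly_matrix_entry {n : Type*} [Fintype n] [DecidableEq n] (A B : Matrix n n K) (i k : n) (s : ℕ) : hkFun K (fun j => (A ^ j * B) i k) s A.charpoly = 0 := by
  rw [hkFun_matrix_entry, Matrix.aeval_self_charpoly, Matrix.zero_mul, Matrix.zero_mul, Matrix.zero_apply]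

/-- **EVERY MATRIX-ENTRY SEQUENCE `j ↦ (A^j · B)_{ik}` OF AN `n × n` MATRIX HAS `R^N ≤ n` FOR EVERY `N`** (the monic recurrence `χ_A` of order `n` holds at every shift; N97). -/
theorem rank_half_matrix_entry_le {n : Type*} [Fintype n] [DecidableEq n] [Nonempty n] (A B : Matrix n n K) (i k : n) (N : ℕ) :
    (hankel1 K N (N / 2) fun j => (A ^ j * B) i k).rank ≤ Fintype.card n :=
  (forall_rank_half_le_iff_exists_recurrence K _ _).mpr ⟨A.charpoly, Matrix.charpoly_monic A, (Matrix.charpoly_natDegree_eq_dim A).le, fun s => hkFun_charpoly_matrix_entry K A B i k s⟩ N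

/-- **THE MATRIX MODEL OF A DUAL CLASS: `dualSeq m a j = (M_X^j · M_a)_{t,0}`** for `m` monic of degree `t + 1` (`M_X^j M_a = M_{X^j a}`, N91, whose `(t, 0)` entry is `[X^t](X^j a mod m)`): the
LFSR state-space model. -/
theorem dualSeq_eq_mulResidueMat_pow_entry {t : ℕ} {m : K[X]} (hm : m.Monic) (hmd : m.natDegree = t + 1) (a : K[X]) (j : ℕ) :
    dualSeq K m a j = (mulResidueMat K t m Polynomial.X ^ j * mulResidueMat K t m a) (Fin.last t) 0 := by
  rw [← mulResidueMat_X_pow K hm hmd, ← mulResidueMat_mul K hm hmd, mulResidueMat_apply, dualSeq_apply, hmd, Nat.add_sub_cancel, Fin.val_last, Fin.val_zero, pow_zero, one_mul]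

end Summit.Ventures.HSemireg.Wedge.HankelOuter
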